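import Summits.HodgeConjecture.CorCM.D2Bridge.ClosedPrintedMuKeyIdentLemD3DelRecConjOmegaT
import Literature.RepresentationTheory.MoeglinVignerasWaldspurger1987.RankOneThetaLiftIrreducibleProofs
import Literature.NumberTheory.Automorphic.Zelevinsky1980.UnitaryCharacterInductionIrreducible
import Summits.HodgeConjecture.HodgeConjecture.Theses.HCCMUnconditional
import Summits.HodgeConjecture.CorCM.HypD1pp.A4LiuD1ppHeadOfFacts
import Literature.NumberTheory.GelbartRogawski1991.FiniteAdelicWeilCentralCoinvariantsAdmissible
import Literature.NumberTheory.Automorphic.Liu2021.Def411WeilCarriersAdmissibleOfLemD1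
import Literature.NumberTheory.Automorphic.HyperspecialGelfandPair
import Literature.NumberTheory.Automorphic.HyperspecialGelfandPairProofs
import Literature.NumberTheory.Automorphic.Liu2021.SplitPlaceOscillatorModelProofs   -- IV-3(a): B-p08 p602828 `splitPlace_chiCoinv_iso_parabolicIndGL_of_isIrreducible`
import HarnessLib

/-!
# `HCCMUnconditional.H411` — the closing file of item stmt-HodgeConjecture-24836 (binder `h411`, [Liu 2021, Def. 4.11] AS PRINTED)

Topic: summit `HodgeConjecture`, sub-problem `HodgeConjecture`, route `HCCMUnconditional` (Theses file of record), crux `H411`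
(= the pack decl `PrintedCitationHypotheses.Hyp411` by `rfl`).  PROVER FILE (cell hodgecm-mathlib, seat B-p19; D-0016): ONE theorem,
`Summit.HodgeConjecture.HodgeConjecture.Theorems.H411_proof : …Theses.HCCMUnconditional.H411`, sorry-free, axioms ⊆ the trio.

It is A-plan2's line `a4_liu411` (crux workfile `Cruxes/H411/Lines/a4_liu411.lean`, v4/v5, head `Hyp411_of` — NOT importable since it carries the
registered stub slot) with EVERY stub replaced BY NAME by its landed discharge:
* `LemD1AllPairs` (Lem. D.1 (1) per place at every pair) := B-p01's head-tree
  `Summit.HodgeConjecture.CorCM.HypD1pp.lemD1AllPairs_of_facts` (p599646) fed with the THREE residual interface facts, all DISCHARGED IN TREE: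
  IV-1a `MoeglinVignerasWaldspurger1987.mvw_IV4_rankOne_irreducibleOrZero_holds` (B-p02 p601137), IV-3(a)
  `Liu2021.splitPlace_chiCoinv_iso_parabolicIndGL_of_isIrreducible` (B-p08 p602828) applied to IV-3(b)
  `Zelevinsky1980.parabolicIndGL_detChar_unitary_isIrreducible_holds.{0}` (B-p09/B-p11/B-p17 p601139), and IV-3(b) itself;
* `FlathAdmissibleCentralCoinv` := A-p12's `finiteAdeleRep_centralCoinv_isAdmissible` (p594410);
* `RhoAtLineAdmissibleOfLemD1` := A-p13's `Def411WeilCarriers.rhoAtLine_isAdmissibleRep_of_lemD1AsPrinted` (p600077);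
* `HyperspecialGelfandPair` := B-p11's `HyperspecialGelfandPair_holds` (p595758).
The composition term is `Hyp411_of`'s, character for character otherwise ([Liu2021, Def. 4.11, FJcycle.tex l. 2083–2097]: at each pair `(ε, χ)`
«irreducible-or-zero» = `isIrreducibleOrZero_of_isIrreducible ∘ rhoAtLine_isIrreducible_of_lemD1AsPrinted`, «smooth» = `rhoAtLine_smooth`,
«admissible» = the admissibility theorem at the face data).  With this file the binder `h411` of the headline
`hc_cm_of_printed_citations_muKey_ident_lemD3_delRecConjOmegaT` is discharged in-tree.  HC_CM is proved only modulo the 7 printed citations until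
rung 0 closes (after `h411` and `hD1''`: 5 remain).

## References
* [Liu2021] Y. Liu, Camb. J. Math. 9 (2021) = arXiv:2102.11518: Def. 4.11 (l. 2083–2097); App. D Lem. D.1 (1) (l. 5227–5229, 5246–5253).
* [MoeglinVignerasWaldspurger1987] LNM 1291, Chap. 3 IV.4.  [Zelevinsky1980] Thm 4.2.  [Flath1979] §2 Example 2.  [GetzHahn2024] Thm 5.5.1.
-/

set_option autoImplicit false

-- `Summit.HodgeConjecture.HodgeConjecture.Theorems` is the mandated namespace (single-problem summit: Problem = Summit), which
-- `linter.dupNamespace` flags; the lakefile turns the linter off tree-wide (weak option), restated here so stand-alone elaboration is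
-- warning-free too.
set_option linter.dupNamespace false

noncomputable section

namespace Summit.HodgeConjecture.CorCM.Lines.A4Liu411Closing

open scoped Matrix Kronecker TensorProduct Classical RestrictedProduct
open NumberField NumberField.mixedEmbedding IsDedekindDomain Filter Set
open Literature.NumberTheory Literature.NumberTheory.Automorphic Literature.NumberTheory.Automorphic.UnitaryGroup
open Literature.NumberTheory.GelbartRogawski1991 Literature.NumberTheory.GelbartRogawski1991.UnitaryDualPair
open Literature.NumberTheory.GelbartRogawski1991.UnitaryDualPair.WeilCoinv
open Literature.NumberTheory.Weil1964 Literature.RepresentationTheory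
open Literature.RepresentationTheory.HeisenbergGroup
open Literature.GroupTheory.RestrictedProductCharacter
open Literature.NumberTheory.Automorphic.Liu2021 Literature.NumberTheory.Automorphic.Liu2021.Def411WeilCarriers
open scoped TensorProduct Matrix
open NumberField NumberField.InfinitePlace
open HodgeCM.Model HodgeCM.Model.LiuIndex HodgeCM.Model.TowerCarrier
open HodgeCM.Literature.Theta.LiuAlbaneseModuleDatum.D2Bridge (HcmPieces)
open Summit.HodgeConjecture.CorCM.Model
open Literature.AlgebraicGeometry.Motives (CMType)
open Literature.AlgebraicGeometry.HodgeTheory Literature.NumberTheory.Automorphic.PicardCM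
open Literature.AlgebraicGeometry.ShimuraVarieties.UnitaryCanonicalModel
open Literature.NumberTheory.ComplexMultiplication
open Literature.NumberTheory.Automorphic
open Literature.NumberTheory.Automorphic.IdeleClassGroup (toHeckeCharacter isUnitary_toHeckeCharacter galConj)
open Literature.NumberTheory.Automorphic.Liu2021 Literature.NumberTheory.Automorphic.Liu2021.AppendixC
open Literature.NumberTheory.Automorphic.Liu2021.AppendixC.RestOne
open Literature.NumberTheory.Automorphic.Liu2021.Def411WeilCarriers (lineOf locF Rep)
open Summit.HodgeConjecture.CorCM.Transposition.OmegaTransport (realUnit)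
open HodgeCM.Model.ArchSideTerm (e₁)
open Literature.NumberTheory.GelbartRogawski1991 Literature.NumberTheory.GelbartRogawski1991.UnitaryDualPair
open Literature.NumberTheory.GelbartRogawski1991.UnitaryDualPair.LocalSplitting (localMu norm_localMu continuous_localMu localMu_toLocalRing_eq_one_iff
  eq_of_forall_localMu_toHeckeCharacter_eq)
open Literature.RepresentationTheory Literature.RepresentationTheory.Liu2021
open Summit.HodgeConjecture.CorCM.Transposition
open Summit.HodgeConjecture.CorCM.D2Bridge.AdapterMuConj (muConj prop413AsPrinted_muConj def411_muConj nontrivial_omegaAt_muConj_rest)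
open Summit.HodgeConjecture.CorCM.D2Bridge.MuKeyIdentEnd (hc_cm_of_printed_citations_muKey_ident)
open Summit.HodgeConjecture.CorCM.D2Bridge.MuKeyIdentLemD3End
open Summit.HodgeConjecture.CorCM.D2Bridge.MuKeyIdentLemD3DelRecConjOmegaEnd (diagonal_frameD_map_complexConj)
open Summit.HodgeConjecture.CorCM.D2Bridge.MuKeyIdentLemD3DelRecConjOmegaEndT (hc_cm_of_printed_citations_muKey_ident_lemD3_delRecConjOmegaT)
open MeasureTheory

set_option synthInstance.maxHeartbeats 400000 in -- as in the line head `Hyp411_of` (a4_liu411 v4): the face terms need deep instance searches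
set_option maxHeartbeats 8000000 in -- as in the line head `Hyp411_of` (a4_liu411 v4): one monolithic `exact` over the Thm-4.18 datum
/-- **`H411_proof` — the route item `HCCMUnconditional.H411` (= `PrintedCitationHypotheses.Hyp411`, [Liu2021, Def. 4.11] AS PRINTED at the tree's
Thm-4.18 datum), UNCONDITIONALLY**: A-plan2's head composition `Hyp411_of` of the line `a4_liu411` with its four inputs replaced by the landed
discharges (module docstring).  Closes item stmt-HodgeConjecture-24836 by type match; discharges binder `h411`.
[cite: Liu2021, Def. 4.11 (FJcycle.tex l. 2083–2097); App. D Lem. D.1 (1)] -/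
theorem _root_.Summit.HodgeConjecture.HodgeConjecture.Theorems.H411_proof :
    Summit.HodgeConjecture.HodgeConjecture.Theses.HCCMUnconditional.H411 := by
  intro hDel F _ h6 ι₁ V a Φ hΦ μ hμ hw ε χ
  exact
    ⟨isIrreducibleOrZero_of_isIrreducible
      (Def411WeilCarriers.rhoAtLine_isIrreducible_of_lemD1AsPrinted ↥(maximalRealSubfield (F : Type)) (F : Type) (IsCMField.complexConj (F : Type)) 3 e₁
        (Matrix.diagonal (frameD V)) (complexConj_imagUnit (F : Type)) (imagUnit_ne_zero (F : Type)) (imagUnit_mul_self (F : Type))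
        (realDiagonal_isSymm (F : Type) (frameD V) (frameD_real V)) (isUnit_det_realDiagonal (F : Type) (frameD V) (frameD_real V) (frameD_ne V))
        (realDiagonal_map (F : Type) (frameD V) (frameD_real V)).symm
        (OmegaChiSplitting.hsChiD ⟨HodgeCM.CMField.K F⟩ e₁ (frameD V) (frameD_real V) (frameD_ne V) (toHeckeCharacter (F : Type) μ) (isUnitary_toHeckeCharacter (F : Type) μ)
        ((isOscillatorChar_toHeckeCharacter_iff μ).mpr hμ))
        (((Rep.update ↥(maximalRealSubfield (HodgeCM.CMField.K F)) (imagUnitSq (HodgeCM.CMField.K F)) (Rep.ofLineOf ↥(maximalRealSubfield (HodgeCM.CMField.K F)) (imagUnitSq (HodgeCM.CMField.K F))) (locF ↥(maximalRealSubfield (HodgeCM.CMField.K F)) (imagUnitSq (HodgeCM.CMField.K F)) (realUnit ⟨HodgeCM.CMField.K F⟩ a.1 a.2.1 a.2.2)) (realUnit ⟨HodgeCM.CMField.K F⟩ a.1 a.2.1 a.2.2) rfl)).toFun ε) χ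
        (OmegaChiSplitting.chiLocalSplittingsD ⟨HodgeCM.CMField.K F⟩ e₁ (frameD V) (frameD_real V) (frameD_ne V) (toHeckeCharacter (F : Type) μ)
        ((isOscillatorChar_toHeckeCharacter_iff μ).mpr hμ) (((Rep.update ↥(maximalRealSubfield (HodgeCM.CMField.K F)) (imagUnitSq (HodgeCM.CMField.K F)) (Rep.ofLineOf ↥(maximalRealSubfield (HodgeCM.CMField.K F)) (imagUnitSq (HodgeCM.CMField.K F))) (locF ↥(maximalRealSubfield (HodgeCM.CMField.K F)) (imagUnitSq (HodgeCM.CMField.K F)) (realUnit ⟨HodgeCM.CMField.K F⟩ a.1 a.2.1 a.2.2)) (realUnit ⟨HodgeCM.CMField.K F⟩ a.1 a.2.1 a.2.2) rfl)).toFun ε))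
        (ι := ιVE V) (isHomeomorph_finPart_cmKTypeHom_finAdelicToAdelic (F : Type) (HodgeCM.HermSpace3.Hm V) (frameG V) (frameD V) (frame_congr V)).surjective
        (OmegaChiSplitting.hfac_sChiD ⟨HodgeCM.CMField.K F⟩ e₁ (frameD V) (frameD_real V) (frameD_ne V) (toHeckeCharacter (F : Type) μ) (isUnitary_toHeckeCharacter (F : Type) μ)
        ((isOscillatorChar_toHeckeCharacter_iff μ).mpr hμ) (((Rep.update ↥(maximalRealSubfield (HodgeCM.CMField.K F)) (imagUnitSq (HodgeCM.CMField.K F)) (Rep.ofLineOf ↥(maximalRealSubfield (HodgeCM.CMField.K F)) (imagUnitSq (HodgeCM.CMField.K F))) (locF ↥(maximalRealSubfield (HodgeCM.CMField.K F)) (imagUnitSq (HodgeCM.CMField.K F)) (realUnit ⟨HodgeCM.CMField.K F⟩ a.1 a.2.1 a.2.2)) (realUnit ⟨HodgeCM.CMField.K F⟩ a.1 a.2.1 a.2.2) rfl)).toFun ε))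
        (le_refl 3) (localMu (F : Type) (toHeckeCharacter (F : Type) μ)) (fun v x => norm_localMu (F : Type) (toHeckeCharacter (F : Type) μ) v (isUnitary_toHeckeCharacter (F : Type) μ) x)
        (continuous_localMu (F : Type) (toHeckeCharacter (F : Type) μ)) (fun v t => localMu_toLocalRing_eq_one_iff (F : Type) (toHeckeCharacter (F : Type) μ) v ((isOscillatorChar_toHeckeCharacter_iff μ).mpr hμ) t)
        (fun v => (Summit.HodgeConjecture.CorCM.HypD1pp.lemD1AllPairs_of_facts
          Literature.RepresentationTheory.MoeglinVignerasWaldspurger1987.mvw_IV4_rankOne_irreducibleOrZero_holds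
          (Literature.NumberTheory.Automorphic.Liu2021.splitPlace_chiCoinv_iso_parabolicIndGL_of_isIrreducible
            Literature.NumberTheory.Automorphic.Zelevinsky1980.parabolicIndGL_detChar_unitary_isIrreducible_holds.{0})
          Literature.NumberTheory.Automorphic.Zelevinsky1980.parabolicIndGL_detChar_unitary_isIrreducible_holds.{0}) hDel F h6 V a Φ hΦ μ hμ hw ε χ v)),
    Def411WeilCarriers.rhoAtLine_smooth ↥(maximalRealSubfield (F : Type)) (F : Type) (IsCMField.complexConj (F : Type)) 3 e₁
        (Matrix.diagonal (frameD V)) (complexConj_imagUnit (F : Type)) (imagUnit_ne_zero (F : Type)) (imagUnit_mul_self (F : Type))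
        (realDiagonal_isSymm (F : Type) (frameD V) (frameD_real V)) (isUnit_det_realDiagonal (F : Type) (frameD V) (frameD_real V) (frameD_ne V))
        (realDiagonal_map (F : Type) (frameD V) (frameD_real V)).symm
        (OmegaChiSplitting.hsChiD ⟨HodgeCM.CMField.K F⟩ e₁ (frameD V) (frameD_real V) (frameD_ne V) (toHeckeCharacter (F : Type) μ) (isUnitary_toHeckeCharacter (F : Type) μ)
        ((isOscillatorChar_toHeckeCharacter_iff μ).mpr hμ))
        (ιVE V) (continuous_ιVE V)
        (OmegaChiSplitting.hscChiD ⟨HodgeCM.CMField.K F⟩ e₁ (frameD V) (frameD_real V) (frameD_ne V) (toHeckeCharacter (F : Type) μ) (isUnitary_toHeckeCharacter (F : Type) μ)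
        ((isOscillatorChar_toHeckeCharacter_iff μ).mpr hμ))
        (((Rep.update ↥(maximalRealSubfield (HodgeCM.CMField.K F)) (imagUnitSq (HodgeCM.CMField.K F)) (Rep.ofLineOf ↥(maximalRealSubfield (HodgeCM.CMField.K F)) (imagUnitSq (HodgeCM.CMField.K F))) (locF ↥(maximalRealSubfield (HodgeCM.CMField.K F)) (imagUnitSq (HodgeCM.CMField.K F)) (realUnit ⟨HodgeCM.CMField.K F⟩ a.1 a.2.1 a.2.2)) (realUnit ⟨HodgeCM.CMField.K F⟩ a.1 a.2.1 a.2.2) rfl)).toFun ε) χ,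
    Literature.NumberTheory.Automorphic.Liu2021.Def411WeilCarriers.rhoAtLine_isAdmissibleRep_of_lemD1AsPrinted
        (fun K _ _ ι _ _ _ _ _ r hK _ _ _ φ hφ _ _ _ hKo hKcc hc hcomm χ hχ hχK _ hx₀N hadm hsph =>
          Literature.NumberTheory.Automorphic.finiteAdeleRep_centralCoinv_isAdmissible K ι r hK φ hφ hKo hKcc hc hcomm χ hχ hχK hx₀N hadm hsph)
        Literature.NumberTheory.Automorphic.HyperspecialGelfandPair_holds ↥(maximalRealSubfield (F : Type)) (F : Type) (IsCMField.complexConj (F : Type)) 3 e₁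
        (Matrix.diagonal (frameD V)) (complexConj_imagUnit (F : Type)) (imagUnit_ne_zero (F : Type)) (imagUnit_mul_self (F : Type))
        (realDiagonal_isSymm (F : Type) (frameD V) (frameD_real V)) (isUnit_det_realDiagonal (F : Type) (frameD V) (frameD_real V) (frameD_ne V))
        (realDiagonal_map (F : Type) (frameD V) (frameD_real V)).symm
        (OmegaChiSplitting.hsChiD ⟨HodgeCM.CMField.K F⟩ e₁ (frameD V) (frameD_real V) (frameD_ne V) (toHeckeCharacter (F : Type) μ) (isUnitary_toHeckeCharacter (F : Type) μ)
        ((isOscillatorChar_toHeckeCharacter_iff μ).mpr hμ))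
        (((Rep.update ↥(maximalRealSubfield (HodgeCM.CMField.K F)) (imagUnitSq (HodgeCM.CMField.K F)) (Rep.ofLineOf ↥(maximalRealSubfield (HodgeCM.CMField.K F)) (imagUnitSq (HodgeCM.CMField.K F))) (locF ↥(maximalRealSubfield (HodgeCM.CMField.K F)) (imagUnitSq (HodgeCM.CMField.K F)) (realUnit ⟨HodgeCM.CMField.K F⟩ a.1 a.2.1 a.2.2)) (realUnit ⟨HodgeCM.CMField.K F⟩ a.1 a.2.1 a.2.2) rfl)).toFun ε) χ
        (OmegaChiSplitting.chiLocalSplittingsD ⟨HodgeCM.CMField.K F⟩ e₁ (frameD V) (frameD_real V) (frameD_ne V) (toHeckeCharacter (F : Type) μ)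
        ((isOscillatorChar_toHeckeCharacter_iff μ).mpr hμ) (((Rep.update ↥(maximalRealSubfield (HodgeCM.CMField.K F)) (imagUnitSq (HodgeCM.CMField.K F)) (Rep.ofLineOf ↥(maximalRealSubfield (HodgeCM.CMField.K F)) (imagUnitSq (HodgeCM.CMField.K F))) (locF ↥(maximalRealSubfield (HodgeCM.CMField.K F)) (imagUnitSq (HodgeCM.CMField.K F)) (realUnit ⟨HodgeCM.CMField.K F⟩ a.1 a.2.1 a.2.2)) (realUnit ⟨HodgeCM.CMField.K F⟩ a.1 a.2.1 a.2.2) rfl)).toFun ε))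
        (ι := ιVE V) (continuous_ιVE V)
        (isHomeomorph_finPart_cmKTypeHom_finAdelicToAdelic (F : Type) (HodgeCM.HermSpace3.Hm V) (frameG V) (frameD V) (frame_congr V)).isOpenMap
        (OmegaChiSplitting.hfac_sChiD ⟨HodgeCM.CMField.K F⟩ e₁ (frameD V) (frameD_real V) (frameD_ne V) (toHeckeCharacter (F : Type) μ) (isUnitary_toHeckeCharacter (F : Type) μ)
        ((isOscillatorChar_toHeckeCharacter_iff μ).mpr hμ) (((Rep.update ↥(maximalRealSubfield (HodgeCM.CMField.K F)) (imagUnitSq (HodgeCM.CMField.K F)) (Rep.ofLineOf ↥(maximalRealSubfield (HodgeCM.CMField.K F)) (imagUnitSq (HodgeCM.CMField.K F))) (locF ↥(maximalRealSubfield (HodgeCM.CMField.K F)) (imagUnitSq (HodgeCM.CMField.K F)) (realUnit ⟨HodgeCM.CMField.K F⟩ a.1 a.2.1 a.2.2)) (realUnit ⟨HodgeCM.CMField.K F⟩ a.1 a.2.1 a.2.2) rfl)).toFun ε))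
        (le_refl 3) (localMu (F : Type) (toHeckeCharacter (F : Type) μ)) (fun v x => norm_localMu (F : Type) (toHeckeCharacter (F : Type) μ) v (isUnitary_toHeckeCharacter (F : Type) μ) x)
        (continuous_localMu (F : Type) (toHeckeCharacter (F : Type) μ)) (fun v t => localMu_toLocalRing_eq_one_iff (F : Type) (toHeckeCharacter (F : Type) μ) v ((isOscillatorChar_toHeckeCharacter_iff μ).mpr hμ) t)
        (fun v => (Summit.HodgeConjecture.CorCM.HypD1pp.lemD1AllPairs_of_facts
          Literature.RepresentationTheory.MoeglinVignerasWaldspurger1987.mvw_IV4_rankOne_irreducibleOrZero_holds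
          (Literature.NumberTheory.Automorphic.Liu2021.splitPlace_chiCoinv_iso_parabolicIndGL_of_isIrreducible
            Literature.NumberTheory.Automorphic.Zelevinsky1980.parabolicIndGL_detChar_unitary_isIrreducible_holds.{0})
          Literature.NumberTheory.Automorphic.Zelevinsky1980.parabolicIndGL_detChar_unitary_isIrreducible_holds.{0}) hDel F h6 V a Φ hΦ μ hμ hw ε χ v)⟩


end Summit.HodgeConjecture.CorCM.Lines.A4Liu411Closing

end
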